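import Summits.QuantumFields.BalabanUV.Beta.FP.TowerFWindingRow

/-!
# `BalabanUV.Beta.FP.TowerGLiteralLetters` — road «FP», binder row D1, ROUTE T (β1), (H5-G) TABLED: **THE G-SYSTEM's FAMILY, WINDING AND `hG` LETTERS AT THE LITERAL
# TOP STEP** — at the choice `𝒱G (n+1) := vertexOfK (GcombSh Lc (n+1)) Lc (JsB12CombSh⁰ … (n+1)).S`, `𝒲G (n+1) := (JsB12CombSh⁰ … (n+1)).W`, `𝒲bG (n+1) B :=` its source-wound
# even half on `Mc B`, `NG n := Lc` (an2 g79 W-5 (3) l.68883: «keep the G data FREE … until the other ELEVEN G-letters are tabled BY NAME at that choice»), v10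
# `StepRecursionFeedNestedNamedI`'s binders `hVG hWG hδG` (L.257–259, `∃`-form), `hWGw` (L.260) and `hG` (L.273) ARE THEOREMS, CHARACTER FOR CHARACTER

WHY (located).  Road g59 A-1 l.69037 (G-LIT): with the F-side by name down to its four door-jet junctions (`TowerFWindingRow`, END at the record 37), the (H5-G) box is the
largest by-name-typable group left — at the literal top step 8 of its 12 letters + (H6) `hG` are tree-letter compositions, leaving exactly the four KKT-transport junctions
`hHG₁ hQG₁ hHG₂ hQG₂` ((T-ID)∕(C1) class) and `hT0 hT1`.  THIS FILE tables the three family letters, the winding letter and `hG` (the parities `hVGm hVGt hWGm hWGt` are FILE G2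
`TowerGLiteralParities`).  LETTERS ONLY: nothing of v10 ∕ the END is touched; whether the END takes its G-system here is the row's ∕ the referee's call (skeleton P is an xread).

THE CANDIDATE, HONESTLY (an2 g81 W-5 l.69039 (4)): this `G` is «the literal's own top step read through the comb chart `GcombSh Lc (n+1)`» — v10 displays the G-leg as
`GcombSh Lc (n + 1 - 0)`; `JsB12CombSh0 … (n+1)` is the RAW (undressed) jet record, the two dressing functors living in `GcombSh` (the row's `CombChartJointEnd.TbalOf_JsB12CombShSym`,
as FILE 6 `TowerFAnchorRow` reads it at level `0`).  The END's choice of `G` STAYS FREE (W-5 (3) l.68883 stands at the END of record); these are library letters about a NAMED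
candidate, true whatever the END instantiates; skeletons P ∕ Q are xreads, NOT filed, and their count is NOT the END of record's.

WHAT ([folklore] composition BY NAME; no `def`, no `def … : Prop`, nothing cited, 0 sorry).
* §1 **`vertexFamilies_Glit j`** — the literal's level-`j` pair `(vertexOfK G′_j Lc (JsB12CombSh⁰ … j).S, (JsB12CombSh⁰ … j).W)` are `VertexFamily ∕ VertexFamily₂` at blocking `Lc` with ONE
  common rate (lit `OneStepKernelFamily.vertexFamily_vertexOfK'` at an2 `decays_GcombSh j` + the jet record's own `loc ∕ δ_pos ∕ loc₂`; FILE 6 `TowerFAnchorRow.vertexFamilies_G0` is `j = 0`);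
  the END feeds `CvG CwG δG n := Classical.choose …`, `hVG hWG hδG :=` the conjuncts at `j := n + 1`.
* §2 **`hWGw_lit`** — v10's `hWGw` (L.260) CHARACTER FOR CHARACTER under σ_G: `TowerFWindingRow.winding_letter_evenWound_of_swap` on the top torus `fine Lc (Mc B)` (growth from
  `hMc`), leg `GcombSh Lc (n + 1 - 0)` (`decays_GcombSh`, `RelInvPeriodisedComb.shiftK_GcombSh'` → gan24 `translate_invariant_of_shiftK` with `Lc ∣ Lc·Mc B i`,
  `CombChartWardSockets.trK_GcombSh`), family `loc₂ ∕ δ_pos` + `TowerFWindingRow.WGlit_swap (n + 1)`.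
* §3 **`hG_lit`** — v10's `hG` (L.273) CHARACTER FOR CHARACTER under σ_G: `CombChartJointEnd.TbalOf_JsB12CombShSym` (road g56's xread v7 ∕ `mkEndSkel --part77h2g` one-line `rw`).
Junction: `g59/rec/mkGlit.py` emits the σ_G-instantiated binder texts from the twin; skeleton P (`mkEndSkel59.py --wind --glit`) is the xread.
WHAT THIS IS NOT: not the parities (FILE G2); not the junctions `hHG₁ hQG₁ hHG₂ hQG₂` (KKT-transport identities `L·H₁f − S·[Q₁₁f; 0] …` of the top step = (T-ID)∕(C1) class);
not `hT0 hT1` (the literal's zero- ∕ first-moment rows — (T-ID) class, `RowD1Telescoping`'s targets); NO END edit; nothing of Bałaban's asserted, valued or discharged; 0 estimates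
beyond [folklore] geometric series BY NAME; 0∕4 row-D1 binders (hW ∕ hR ∕ D1Tel ∕ D1Rep); ROOT M‴ p325680 ∕ P5c ∕ D6 untouched; NOT (C1), NOT (T-ID), NOT D1, NEVER «G-an2-4 closed»,
NOT BetaPertH, NOT continuum, NOT Clay.
HONEST DEPENDENCY (page 1, mandatory): continuum YM on T⁴ ⇐ BetaPertH ∧ nine spine estimates (0/9 proved); BetaPertH ⇐ (D1) ∧ (D4) ∧ CAP+tail;
G-an2-4 gates asym, D1 and NE2/3/4.  HONEST FRAMING (cell contract, verbatim): «discharging `BetaPertH` makes Bałaban's UV stability UNCONDITIONAL —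
a real constructive-QFT result; it is NOT the continuum limit and NOT the Clay problem.»  ABSOLUTE RULE (cell charter, verbatim): «No internally-minted
statement may enter as a cited fact. Every hypothesis is either kernel-proved in this package or a verbatim quotation of a PUBLISHED theorem with page
reference. The manuscript(s) under audit are NOT citable for their own disputed steps — they are the thing under adjudication; programme-internal
(2001/route/tribunal) claims are never citable.»  Road «FP» OWNER, b2b-balaban-beta-d1-p3 gen 59, 2026-08-29.  No existing file touched.
-/

noncomputable section

open scoped BigOperators Matrix Topology
open Finset Filter

namespace Summit.QuantumFields.BalabanUV.Beta.FP.TowerGLiteralLetters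

open Literature.MathematicalPhysics.QuantumFieldTheory
open Literature.MathematicalPhysics.QuantumFieldTheory.Balaban1983to89
open Literature.MathematicalPhysics.QuantumFieldTheory.Balaban1983to89.Beta
open B4TorusKernel.MultiPeriod (translate)
open B5Prop11Plancherel (fine)
open ExpKernelCalculus (Site MKer Decays BiLoc VertexFamily VertexFamily₂ hessKer)
open OneStepResolventKernel (Fib biLoc_mono)
open OneStepKernelFamily (vertexOfK vertexFamily_vertexOfK' TbalOf)
open BalabanStepJets (vertexFamily₂_mono)
open Summit.QuantumFields.BalabanUV.Beta.TameKernelCalculus (trK)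
open Summit.QuantumFields.BalabanUV.Beta.BorderedHessian (sgnK)
open Summit.QuantumFields.BalabanUV.Beta.SymSecondOrderTablesAn1 (symTablesAn1S2)
open Summit.QuantumFields.BalabanUV.Beta.CombChartStepJets (GcombSh decays_GcombSh JsB12CombSh0)
open Summit.QuantumFields.BalabanUV.Beta.CombChartJointEnd (JsB12CombShSym TbalOf_JsB12CombShSym)
open Summit.QuantumFields.BalabanUV.Beta.CombChartWardSockets (trK_GcombSh)
open Summit.QuantumFields.BalabanUV.Beta.FP.KernelPeriodisationFib (perF translate_invariant_of_shiftK)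
open Summit.QuantumFields.BalabanUV.Beta.FP.KernelPeriodisationFibLoc (dper)
open Summit.QuantumFields.BalabanUV.Beta.FP.RelInvPeriodisedComb (shiftK_GcombSh')
open Summit.QuantumFields.BalabanUV.Beta.FP.TowerFWindingRow (winding_letter_evenWound_of_swap WGlit_swap)

/-! ## §1 The literal's level-`j` pair are vertex families at blocking `Lc` (v10's `hVG hWG hδG` at `NG n := Lc`, `j := n + 1`, `∃`-form) -/

section Families

variable (Lc : ℕ) [NeZero Lc] (hLc : Odd Lc) (N : ℕ) (cΛ cB : ℝ)

/-- [folklore] **THE LITERAL's LEVEL-`j` PAIR ARE VERTEX FAMILIES AT BLOCKING `Lc` WITH ONE COMMON RATE** (lit `vertexFamily_vertexOfK'` at `decays_GcombSh j` and the jet record's own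
`loc ∕ δ_pos`; the record's `loc₂`; rates `min`-ed).  FILE 6's `vertexFamilies_G0` is the case `j = 0`.  The END feeds `NG n := Lc`, `CvG CwG δG n := Classical.choose (… (n + 1))`,
`hδG ∕ hVG ∕ hWG n :=` the three conjuncts. -/
theorem vertexFamilies_Glit (j : ℕ) : ∃ Cv Cw δ : ℝ, 0 < δ ∧
    VertexFamily (vertexOfK (GcombSh (d := 3) Lc j) Lc (JsB12CombSh0 hLc N (symTablesAn1S2 3 Lc cΛ) cΛ cB j).S) Lc Cv δ ∧
    VertexFamily₂ (JsB12CombSh0 hLc N (symTablesAn1S2 3 Lc cΛ) cΛ cB j).W Lc Cw δ := by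
  set J := JsB12CombSh0 hLc N (symTablesAn1S2 3 Lc cΛ) cΛ cB j with hJ
  obtain ⟨Cv, δv, hδv, hV⟩ := vertexFamily_vertexOfK' (N := Lc) (K := GcombSh (d := 3) Lc j) (decays_GcombSh (d := 3) Lc j) J.loc J.δ_pos
  have hW : VertexFamily₂ J.W Lc J.Cw J.δ := J.loc₂
  have hCv : 0 ≤ Cv := (hV 0 0).nonneg (Sum.inl 0)
  have hCw : 0 ≤ J.Cw := (hW 0 0 0 0).nonneg (Sum.inl 0)
  exact ⟨Cv, J.Cw, min δv J.δ, lt_min hδv J.δ_pos, fun μ y => biLoc_mono (hV μ y) hCv (min_le_left _ _),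
    vertexFamily₂_mono hW hCw (min_le_right _ _)⟩

/-- [folklore] **`hG` AT THE LITERAL TOP STEP** — v10 `StepRecursionFeedNestedNamedI.d1Tel_JcComp_ctr_namedI`'s binder `hG` (L.273) CHARACTER FOR CHARACTER under
σ_G = {`(𝒱G j)` ↦ `(vertexOfK (GcombSh Lc j) Lc (JsB12CombSh0 … j).S)`, `(𝒲G j)` ↦ `(JsB12CombSh0 … j).W`}: `CombChartJointEnd.TbalOf_JsB12CombShSym` (the `1 ≤ j` is carried, not used). -/
theorem hG_lit : ∀ j : ℕ, 1 ≤ j → ∀ (μ ν : Fin 4) (z : Fin 4 → ℤ), hessKer (GcombSh (d := 3) Lc j) (vertexOfK (GcombSh (d := 3) Lc j) Lc (JsB12CombSh0 hLc N (symTablesAn1S2 3 Lc cΛ) cΛ cB j).S) (JsB12CombSh0 hLc N (symTablesAn1S2 3 Lc cΛ) cΛ cB j).W μ ν z = TbalOf Lc (JsB12CombShSym hLc N (symTablesAn1S2 3 Lc cΛ) cΛ cB) j μ ν z := by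
  intro j _ μ ν z
  rw [TbalOf_JsB12CombShSym]

end Families

/-! ## §2 The G-winding letter at the literal top step (v10's `hWGw`, L.260) -/

section Winding

variable (Lc : ℕ) [NeZero Lc] (hLc : Odd Lc) (N : ℕ) (cΛ cB : ℝ)
  (Mc : ℕ → (Fin (3 + 1) → ℕ)) [∀ B μ, NeZero (Mc B μ)] (hMc : ∀ K : ℕ, ∀ᶠ B in atTop, ∀ i, K ≤ Mc B i)
include hMc

/-- [folklore] **`hWGw` AT THE LITERAL TOP STEP** — v10's binder `hWGw` (L.260) CHARACTER FOR CHARACTER under σ_G = {`(𝒲G (n + 1))` ↦ `(JsB12CombSh0 … (n + 1)).W`, `(𝒲bG (n + 1)) B` ↦ its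
source-wound even half on `Mc B`}: `TowerFWindingRow.winding_letter_evenWound_of_swap` on the top torus `fine Lc (Mc B)` fed the leg's letters at `GcombSh Lc (n + 1 - 0)` (an2 `decays_GcombSh`;
`shiftK_GcombSh'` → `translate_invariant_of_shiftK` with `Lc ∣ fine Lc (Mc B) i`; `trK_GcombSh`) and the family's (the jet record's `loc₂ ∕ δ_pos`, `WGlit_swap (n + 1)`). -/
theorem hWGw_lit (n : ℕ) (μ ν : Fin (3 + 1)) (z : Fin (3 + 1) → ℤ) : Tendsto (fun B : ℕ => Matrix.trace (perF (fine Lc (Mc B)) (GcombSh (d := 3) Lc ((n + 1 - 0))) * perF (fine Lc (Mc B)) (dper (fine Lc (Mc B)) ((fun μ y ν y' => (fun x z a b => ∑' e : Site (3 + 1), ((1 / 2 : ℝ) • ((JsB12CombSh0 hLc N (symTablesAn1S2 3 Lc cΛ) cΛ cB (n + 1)).W μ y ν (translate (Mc B) y' e) + sgnK (trK ((JsB12CombSh0 hLc N (symTablesAn1S2 3 Lc cΛ) cΛ cB (n + 1)).W μ y ν (translate (Mc B) y' e))))) x z a b)) μ 0 ν z))) - Matrix.trace (perF (fine Lc (Mc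 B)) (GcombSh (d := 3) Lc ((n + 1 - 0))) * perF (fine Lc (Mc B)) (dper (fine Lc (Mc B)) ((JsB12CombSh0 hLc N (symTablesAn1S2 3 Lc cΛ) cΛ cB (n + 1)).W μ 0 ν z)))) atTop (𝓝 0) := by
  have hL0 : 0 < Lc := Nat.pos_of_ne_zero (NeZero.ne Lc)
  set J := JsB12CombSh0 hLc N (symTablesAn1S2 3 Lc cΛ) cΛ cB (n + 1) with hJ
  obtain ⟨α, CA, hα, -, hA⟩ := decays_GcombSh (d := 3) Lc (n + 1 - 0)
  have hT : ∀ K : ℕ, ∀ᶠ B in atTop, ∀ i, K ≤ fine Lc (Mc B) i :=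
    fun K => (hMc K).mono fun B hB i => le_trans (hB i) (Nat.le_mul_of_pos_left _ hL0)
  have hAinv : ∀ (B : ℕ) (m x y : Fin (3 + 1) → ℤ) (a b : Fib 3),
      GcombSh (d := 3) Lc (n + 1 - 0) (translate (fine Lc (Mc B)) x m) (translate (fine Lc (Mc B)) y m) a b = GcombSh (d := 3) Lc (n + 1 - 0) x y a b :=
    fun B m x y a b => translate_invariant_of_shiftK (fine Lc (Mc B)) (shiftK_GcombSh' (d := 3) (Lc := Lc) (n + 1 - 0)) (fun i => ⟨Mc B i, rfl⟩) m x y a b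
  exact winding_letter_evenWound_of_swap (fun B => fine Lc (Mc B)) Mc hT hMc hA hα (trK_GcombSh (d := 3) (Lc := Lc) (n + 1 - 0)) hAinv
    (WGlit_swap Lc hLc N cΛ cB (n + 1)) J.loc₂ J.δ_pos μ 0 ν z

end Winding

end Summit.QuantumFields.BalabanUV.Beta.FP.TowerGLiteralLetters

end
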